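import Summits.NavierStokesRegularity.NavierStokesRegularity.Theorems.ExtremiserTransienceNearExtremalTransienceExtremiserLiouvilleConstantSpeedBarycentreZeroCorollaries
import Summits.NavierStokesRegularity.NavierStokesRegularity.Theorems.ExtremiserTransienceNearExtremalTransienceExtremiserLiouvilleConstantSpeedIsometryTransport
import Summits.NavierStokesRegularity.NavierStokesRegularity.Theorems.ExtremiserTransienceNearExtremalTransienceExtremiserLiouvilleConstantSpeedEnergyFluxJet
import HarnessLib

/-!
# Crux `ExtremiserTransience.NearExtremalTransience` (stmt-NavierStokesRegularity-21883), line `extremiser_liouville`,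
# stub K1b — ZERO BARYCENTRE AND VANISHING BLOW-DOWN VORTICITY IN A GENERAL FRAME (transport of the multiplier)

`--supports stmt-NavierStokesRegularity-21883` (helper).  Author: prover seat `ns-el-k1b` (g6).  The axial-frame laws of
`…ConstantSpeedBarycentreZero{,Corollaries}` (`∫ v dμ = 0`, `ω_R → 0` in `𝒟′`) are transported to an arbitrary far-field
direction `c ≠ 0`: conjugating `v ↦ R∘v∘R⁻¹` by the isometry of `exists_isometry_to_axis` (`R c = ‖c‖e₂`) and pushing the
multiplier forward (`μ ↦ R_*μ`) preserves the multiplier identity, because the three bilinear densities `a₁, c₁, J₁` are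
isometry-covariant (`curl(R v R⁻¹) = det R·R(curl v)(R⁻¹·)`).

* `A1_conj`, `C1_conj`, `J1_conj` : `a₁, c₁, J₁` of conjugated pairs equal those of the original pair.
* `multiplierIdentity_conj` : the identity for `(R v R⁻¹, R_*μ)` from the identity for `(v, μ)`.
* `integral_barycentre_eq_zero` : **`∫ v dμ = 0`** for every residue object with far field `c ≠ 0`, `v − c ∈ L⁶`.
* `tendsto_blowDown_vorticity_zero_general` : **`R⁻¹∫⟪curl v, B(R⁻¹x)⟫dx → 0` for every `B ∈ C_c^∞`**, general frame.

WHAT THIS IS NOT: K1b is NOT proved; nothing here proves NS regularity. [folklore]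
-/

noncomputable section

open Set Filter Topology MeasureTheory Metric Function
open scoped ENNReal NNReal Topology InnerProductSpace RealInnerProductSpace ContDiff
open Literature.Analysis.FluidPDE Literature.Analysis

namespace Summit.NavierStokesRegularity.NavierStokesRegularity.Theorems

-- the problem directory repeats the summit name (`NavierStokesRegularity/NavierStokesRegularity`)
set_option linter.dupNamespace false

namespace ExtremiserLiouville

open DepletionLadder.KStar DepletionLadder.KStar.HalfSpace

variable {v φ B : E3 → E3} {c : E3} (R : E3 ≃ₗᵢ[ℝ] E3)

/-! ## Covariance of the bilinear densities -/

/-- Polarisation: `Σᵢ ⟪A bᵢ, B bᵢ⟫ = (|A + B|²_F − |A|²_F − |B|²_F)/2` for the standard frame, hence for conjugated operators it is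
invariant: `Σᵢ ⟪(R A R⁻¹) eᵢ, (R B R⁻¹) eᵢ⟫ = Σᵢ ⟪A eᵢ, B eᵢ⟫`. [folklore] -/
theorem sum_inner_conj_eq (A B' : E3 →L[ℝ] E3) :
    ∑ i, ⟪((R : E3 →L[ℝ] E3).comp (A.comp (R.symm : E3 →L[ℝ] E3))) (EuclideanSpace.basisFun (Fin 3) ℝ i),
        ((R : E3 →L[ℝ] E3).comp (B'.comp (R.symm : E3 →L[ℝ] E3))) (EuclideanSpace.basisFun (Fin 3) ℝ i)⟫_ℝ =
      ∑ i, ⟪A (EuclideanSpace.basisFun (Fin 3) ℝ i), B' (EuclideanSpace.basisFun (Fin 3) ℝ i)⟫_ℝ := by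
  have hpol : ∀ (P Q : E3 →L[ℝ] E3), ∑ i, ⟪P (EuclideanSpace.basisFun (Fin 3) ℝ i), Q (EuclideanSpace.basisFun (Fin 3) ℝ i)⟫_ℝ =
      (frobeniusNormSq (P + Q) - frobeniusNormSq P - frobeniusNormSq Q) / 2 := by
    intro P Q
    rw [frobeniusNormSq_eq_sum (EuclideanSpace.basisFun (Fin 3) ℝ), frobeniusNormSq_eq_sum (EuclideanSpace.basisFun (Fin 3) ℝ),
      frobeniusNormSq_eq_sum (EuclideanSpace.basisFun (Fin 3) ℝ), ← Finset.sum_sub_distrib, ← Finset.sum_sub_distrib,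
      Finset.sum_div]
    refine Finset.sum_congr rfl fun i _ => ?_
    rw [FunLike.coe_add, Pi.add_apply, ← real_inner_self_eq_norm_sq, ← real_inner_self_eq_norm_sq, ← real_inner_self_eq_norm_sq,
      inner_add_left, inner_add_right, inner_add_right, real_inner_comm (P _) (Q _)]
    ring
  rw [hpol, hpol, ← ContinuousLinearMap.comp_add, ← ContinuousLinearMap.add_comp, frobeniusNormSq_conj_linearIsometryEquiv,
    frobeniusNormSq_conj_linearIsometryEquiv, frobeniusNormSq_conj_linearIsometryEquiv]

/-- `a₁` is conjugation invariant. [folklore] -/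
theorem A1_conj : A1 (fun y => R (v (R.symm y))) (fun y => R (φ (R.symm y))) = A1 v φ := by
  unfold A1
  have e : (fun x => ⟪curl (fun y => R (v (R.symm y))) x, curl (fun y => R (φ (R.symm y))) x⟫_ℝ) =
      (fun x => ⟪curl v x, curl φ x⟫_ℝ) ∘ R.symm := by
    funext x
    simp only [Function.comp, curl_conj_linearIsometryEquiv, inner_smul_left, inner_smul_right,
      LinearIsometryEquiv.inner_map_map, conj_trivial]
    have h := det_sq_eq_one R
    rw [sq] at h
    rw [← mul_assoc, h, one_mul]
  rw [e]
  exact R.symm.measurePreserving.integral_comp R.symm.toHomeomorph.measurableEmbedding (fun x => ⟪curl v x, curl φ x⟫_ℝ)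

/-- `c₁` is conjugation invariant. [folklore] -/
theorem C1_conj : C1 (fun y => R (v (R.symm y))) (fun y => R (φ (R.symm y))) = C1 v φ := by
  unfold C1
  have e : (fun x => ∑ i, ⟪fderiv ℝ (curl (fun y => R (v (R.symm y)))) x (EuclideanSpace.basisFun (Fin 3) ℝ i),
      fderiv ℝ (curl (fun y => R (φ (R.symm y)))) x (EuclideanSpace.basisFun (Fin 3) ℝ i)⟫_ℝ) =
      (fun x => ∑ i, ⟪fderiv ℝ (curl v) x (EuclideanSpace.basisFun (Fin 3) ℝ i),
        fderiv ℝ (curl φ) x (EuclideanSpace.basisFun (Fin 3) ℝ i)⟫_ℝ) ∘ R.symm := by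
    funext x
    simp only [Function.comp]
    rw [fderiv_curl_conj, fderiv_curl_conj]
    simp only [FunLike.coe_smul, Pi.smul_apply, inner_smul_left, inner_smul_right, conj_trivial]
    have h := det_sq_eq_one R
    rw [sq] at h
    simp_rw [← mul_assoc, h, one_mul]
    exact sum_inner_conj_eq R _ _
  rw [e]
  exact R.symm.measurePreserving.integral_comp R.symm.toHomeomorph.measurableEmbedding
    (fun x => ∑ i, ⟪fderiv ℝ (curl v) x (EuclideanSpace.basisFun (Fin 3) ℝ i),
      fderiv ℝ (curl φ) x (EuclideanSpace.basisFun (Fin 3) ℝ i)⟫_ℝ)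

/-- `J₁` is conjugation invariant. [folklore] -/
theorem J1_conj : J1 (fun y => R (v (R.symm y))) (fun y => R (φ (R.symm y))) = J1 v φ := by
  unfold J1
  set d : ℝ := (R : E3 →L[ℝ] E3).det with hd
  have hd2 : d * d = 1 := by have h := det_sq_eq_one R; rw [← hd, sq] at h; exact h
  have e : (fun x => ⟪curl (fun y => R (φ (R.symm y))) x, fderiv ℝ (fun y => R (v (R.symm y))) x (curl (fun y => R (v (R.symm y))) x)⟫_ℝ +
      ⟪curl (fun y => R (v (R.symm y))) x, fderiv ℝ (fun y => R (φ (R.symm y))) x (curl (fun y => R (v (R.symm y))) x)⟫_ℝ +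
      ⟪curl (fun y => R (v (R.symm y))) x, fderiv ℝ (fun y => R (v (R.symm y))) x (curl (fun y => R (φ (R.symm y))) x)⟫_ℝ) =
      (fun x => ⟪curl φ x, fderiv ℝ v x (curl v x)⟫_ℝ + ⟪curl v x, fderiv ℝ φ x (curl v x)⟫_ℝ +
        ⟪curl v x, fderiv ℝ v x (curl φ x)⟫_ℝ) ∘ R.symm := by
    funext x
    simp only [Function.comp]
    rw [curl_conj_linearIsometryEquiv, curl_conj_linearIsometryEquiv, fderiv_conj_linearIsometryEquiv,
      fderiv_conj_linearIsometryEquiv, ← hd]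
    simp only [ContinuousLinearMap.coe_comp, Function.comp_apply, map_smul]
    have hs : ∀ z : E3, ((R.symm : E3 →L[ℝ] E3) : E3 → E3) (R z) = z := fun z => R.symm_apply_apply z
    have hR : ∀ z : E3, ((R : E3 →L[ℝ] E3) : E3 → E3) z = R z := fun z => rfl
    simp only [hs, hR, inner_smul_left, inner_smul_right, LinearIsometryEquiv.inner_map_map, conj_trivial]
    rw [← mul_assoc, ← mul_assoc, ← mul_assoc, hd2, one_mul, one_mul, one_mul]
  rw [e]
  exact R.symm.measurePreserving.integral_comp R.symm.toHomeomorph.measurableEmbedding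
    (fun x => ⟪curl φ x, fderiv ℝ v x (curl v x)⟫_ℝ + ⟪curl v x, fderiv ℝ φ x (curl v x)⟫_ℝ + ⟪curl v x, fderiv ℝ v x (curl φ x)⟫_ℝ)

/-! ## Transport of the multiplier identity -/

/-- **The multiplier identity is transported**: if `(v, μ)` satisfy g3's identity then so do `(R v R⁻¹, R_*μ)`. [folklore] -/
theorem multiplierIdentity_conj (hv : ContDiff ℝ ∞ v) {M : ℝ} (μ : Measure E3) [IsFiniteMeasure μ]
    (hμ : ∀ φ : E3 → E3, ContDiff ℝ ∞ φ → HasCompactSupport φ → VectorCalculus.IsDivFree φ →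
      Jst v * J1 v φ - kStar ^ 2 * M ^ 2 * (Wpa v * A1 v φ + Zen v * C1 v φ) = ∫ x, ⟪v x, φ x⟫_ℝ ∂μ) :
    ∀ φ' : E3 → E3, ContDiff ℝ ∞ φ' → HasCompactSupport φ' → VectorCalculus.IsDivFree φ' →
      Jst (fun y => R (v (R.symm y))) * J1 (fun y => R (v (R.symm y))) φ' -
          kStar ^ 2 * M ^ 2 * (Wpa (fun y => R (v (R.symm y))) * A1 (fun y => R (v (R.symm y))) φ' +
            Zen (fun y => R (v (R.symm y))) * C1 (fun y => R (v (R.symm y))) φ') =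
        ∫ x, ⟪R (v (R.symm x)), φ' x⟫_ℝ ∂(μ.map R) := by
  intro φ' hφ' hφ'c hφ'div
  -- the pulled-back test field `φ = R⁻¹ φ' R`
  set φ : E3 → E3 := fun x => R.symm (φ' (R.symm.symm x)) with hφdef
  have hφs : ContDiff ℝ ∞ φ := (R.symm : E3 →L[ℝ] E3).contDiff.comp (hφ'.comp (R : E3 →L[ℝ] E3).contDiff)
  have hφc : HasCompactSupport φ := by
    have e' : φ = (fun z : E3 => R.symm z) ∘ φ' ∘ R.toHomeomorph := by funext x; simp [hφdef]
    rw [e']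
    exact (hφ'c.comp_homeomorph R.toHomeomorph).comp_left (map_zero _)
  have hφdiv : VectorCalculus.IsDivFree φ := hφ'div.conj_linearIsometryEquiv R.symm
  have hconj : (fun y => R (φ (R.symm y))) = φ' := by
    funext y; simp [hφdef]
  have hid := hμ φ hφs hφc hφdiv
  rw [← hconj, J1_conj, A1_conj, C1_conj, Jst_conj, Zen_conj, Wpa_conj, hid]
  -- the multiplier side: `∫⟪v, φ⟫dμ = ∫⟪R v R⁻¹, φ'⟫ d(R_*μ)`
  rw [integral_map R.continuous.measurable.aemeasurable]
  · refine integral_congr_ae (Eventually.of_forall fun x => ?_)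
    simp only [hφdef, LinearIsometryEquiv.symm_symm, LinearIsometryEquiv.symm_apply_apply]
    rw [← R.inner_map_map (v x), LinearIsometryEquiv.apply_symm_apply]
  · exact ((R.continuous.comp (hv.continuous.comp R.symm.continuous)).inner
      ((R.continuous.comp (hφs.continuous.comp R.symm.continuous)))).aestronglyMeasurable

/-! ## The general-frame laws -/

/-- **`∫ v dμ = 0` for every residue object, general frame**: `v` smooth, divergence free, `‖v‖ ≡ M = ‖c‖`, `c ≠ 0`,
`D¹v, D²v ∈ L²`, `v − c ∈ L⁶`, `μ` finite with the multiplier identity. [folklore] -/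
theorem integral_barycentre_eq_zero (hv : ContDiff ℝ ∞ v) (hdiv : VectorCalculus.IsDivFree v) {M : ℝ}
    (hM : ∀ x, ‖v x‖ = M) (h1 : ∫⁻ x, ‖iteratedFDeriv ℝ 1 v x‖ₑ ^ 2 < ⊤) (h2 : ∫⁻ x, ‖iteratedFDeriv ℝ 2 v x‖ₑ ^ 2 < ⊤)
    (μ : Measure E3) [IsFiniteMeasure μ]
    (hμ : ∀ ψ : E3 → E3, ContDiff ℝ ∞ ψ → HasCompactSupport ψ → VectorCalculus.IsDivFree ψ →
      Jst v * J1 v ψ - kStar ^ 2 * M ^ 2 * (Wpa v * A1 v ψ + Zen v * C1 v ψ) = ∫ x, ⟪v x, ψ x⟫_ℝ ∂μ)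
    (hc : c ≠ 0) (hcM : ‖c‖ = M) (hL6 : MemLp (fun x => v x - c) 6 volume) :
    (∫ x, v x ∂μ) = 0 := by
  obtain ⟨R, hRc, -, -⟩ := exists_isometry_to_axis hc
  have hcn : ‖c‖ ≠ 0 := norm_ne_zero_iff.2 hc
  set e : E3 := ‖c‖ • EuclideanSpace.single (2 : Fin 3) (1 : ℝ) with he
  have he0 : e 0 = 0 := by simp [he]
  have he1 : e 1 = 0 := by simp [he]
  have he2 : e 2 ≠ 0 := by
    have : e 2 = ‖c‖ := by simp [he]
    rw [this]; exact hcn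
  have heM : ‖e‖ = M := by
    rw [he, norm_smul, Real.norm_eq_abs, abs_of_nonneg (norm_nonneg _), PiLp.norm_single, norm_one, mul_one, hcM]
  set v' : E3 → E3 := fun y => R (v (R.symm y)) with hv'
  have hv's : ContDiff ℝ ∞ v' := (R : E3 →L[ℝ] E3).contDiff.comp (hv.comp (R.symm : E3 →L[ℝ] E3).contDiff)
  have hdiv' : VectorCalculus.IsDivFree v' := hdiv.conj_linearIsometryEquiv R
  have hM' : ∀ y, ‖v' y‖ = M := fun y => by rw [hv', R.norm_map, hM]
  have h1' : ∫⁻ x, ‖iteratedFDeriv ℝ 1 v' x‖ₑ ^ 2 < ⊤ := by rw [hv', lintegral_iteratedFDeriv_conj_eq R 1]; exact h1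
  have h2' : ∫⁻ x, ‖iteratedFDeriv ℝ 2 v' x‖ₑ ^ 2 < ⊤ := by rw [hv', lintegral_iteratedFDeriv_conj_eq R 2]; exact h2
  -- `v' − e ∈ L⁶` by transport
  have hL6' : MemLp (fun y => v' y - e) 6 volume := by
    have hcomp : MemLp (fun y => v (R.symm y) - c) 6 volume :=
      hL6.comp_measurePreserving R.symm.measurePreserving
    refine MemLp.of_le hcomp ((hv's.continuous.sub continuous_const).aestronglyMeasurable) (Eventually.of_forall fun y => ?_)
    show ‖R (v (R.symm y)) - e‖ ≤ ‖v (R.symm y) - c‖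
    rw [← hRc, ← map_sub, R.norm_map]
  -- the transported multiplier
  haveI : IsFiniteMeasure (μ.map R) := Measure.isFiniteMeasure_map μ R
  have hμ' := multiplierIdentity_conj R hv μ hμ
  have hb' := integral_barycentre_eq_zero_of_memLp hv's hdiv' hM' h1' h2' (μ.map R) hμ' he0 he1 he2 heM hL6'
  -- `∫ v' d(R_*μ) = R (∫ v dμ)`
  have hvi : Integrable v μ :=
    (integrable_const M).mono' hv.continuous.aestronglyMeasurable (Eventually.of_forall fun x => (hM x).le)
  have hint : (∫ x, v' x ∂(μ.map R)) = R (∫ x, v x ∂μ) := by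
    rw [integral_map R.continuous.measurable.aemeasurable (hv's.continuous.aestronglyMeasurable)]
    simp only [hv', LinearIsometryEquiv.symm_apply_apply]
    exact ((R : E3 →L[ℝ] E3).integral_comp_comm hvi)
  rw [hint] at hb'
  have h := congrArg R.symm hb'
  rwa [LinearIsometryEquiv.symm_apply_apply, map_zero] at h

/-- **The blow-down vorticity vanishes in `𝒟′` for every residue object, general frame.** [folklore] -/
theorem tendsto_blowDown_vorticity_zero_general (hv : ContDiff ℝ ∞ v) (hdiv : VectorCalculus.IsDivFree v) {M : ℝ}
    (hM : ∀ x, ‖v x‖ = M) (h1 : ∫⁻ x, ‖iteratedFDeriv ℝ 1 v x‖ₑ ^ 2 < ⊤) (h2 : ∫⁻ x, ‖iteratedFDeriv ℝ 2 v x‖ₑ ^ 2 < ⊤)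
    (hpos : 0 < M * Real.sqrt (Zen v) * Real.sqrt (Wpa v))
    (μ : Measure E3) [IsFiniteMeasure μ]
    (hμ : ∀ ψ : E3 → E3, ContDiff ℝ ∞ ψ → HasCompactSupport ψ → VectorCalculus.IsDivFree ψ →
      Jst v * J1 v ψ - kStar ^ 2 * M ^ 2 * (Wpa v * A1 v ψ + Zen v * C1 v ψ) = ∫ x, ⟪v x, ψ x⟫_ℝ ∂μ)
    (hc : c ≠ 0) (hcM : ‖c‖ = M) (hL6 : MemLp (fun x => v x - c) 6 volume)
    (hB : ContDiff ℝ ∞ B) (hBc : HasCompactSupport B) :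
    Tendsto (fun R : ℝ => R⁻¹ * ∫ x, ⟪curl v x, B (R⁻¹ • x)⟫_ℝ) atTop (𝓝 0) := by
  have hM0 : 0 ≤ M := (norm_nonneg _).trans (hM 0).le
  have hMpos : 0 < M := by
    rcases hM0.lt_or_eq with h | h
    · exact h
    · rw [← h, zero_mul, zero_mul] at hpos; exact absurd hpos (lt_irrefl 0)
  have hW : 0 < Wpa v := by
    have hs : 0 < Real.sqrt (Wpa v) := by
      by_contra h
      have h0 : Real.sqrt (Wpa v) = 0 := le_antisymm (not_lt.1 h) (Real.sqrt_nonneg _)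
      rw [h0, mul_zero] at hpos; exact lt_irrefl 0 hpos
    exact Real.sqrt_pos.1 hs
  exact tendsto_blowDown_vorticity_of_barycentre_eq_zero hv hM hMpos hW h1 h2 μ hμ
    (integral_barycentre_eq_zero hv hdiv hM h1 h2 μ hμ hc hcM hL6) hB hBc

end ExtremiserLiouville

end Summit.NavierStokesRegularity.NavierStokesRegularity.Theorems

end
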